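import Summits.BirchSwinnertonDyer.Rank1Residual.X11b.TamagawaQuadraticPlaces
import Literature.NumberTheory.EllipticCurves.Castella2018.Section5Bookkeeping
import HarnessLib

/-!
# X11b, route R1 — Tamagawa numbers in a quadratic base change and a quadratic twist, `p`-adically
# (`p ≥ 5`): link (C) of Castella §5 PROVED for every `E/ℚ`

HONEST FRAMING (cell `b2b-bsdres`, verbatim): the goal of the cell is to DELETE the
COMBINATION-SHAPED residual classes for ALL analytic-rank `≤ 1` curves over `ℚ` — "full BSD
formula for every rank `≤ 1` curve in class C" assembled STRICTLY from published theorems — so that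
the rank-`≤ 1` remainder becomes exactly the CONSTRUCTION-SHAPED classes, which are TYPED
(missing-input `Prop`s), NOT attempted. This is not "finishing BSD". Sub-cell `b2b-bsdres-multr1-p1`,
research route R1 for X11b (Castella 2018 Thm. A re-proved along the author's erratum). THEOREMS
ONLY (no `def`, no named fact, nothing asserted); X11b stays CONSTRUCTION-SHAPED.

Castella, Camb. J. Math. 6 (2018) §5 (arXiv:1704.06608 p. 12) uses "the immediate relation
`Σ_{w∣N} c_w(E/K) = Σ_{ℓ∣N} c_ℓ(E/ℚ) + Σ_{ℓ∣N} c_ℓ(E^D/ℚ)` (see [skinner-zhang])", read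
`p`-adically, for SEMISTABLE `E` (named fact `Castella2018.section5_tamagawaRelation`); the
erratum's "same argument" needs it for every `E`, and no refereed text prints that case
(Jetchev–Skinner–Wan 2017 (eq:tamK) and CGLS 2022 (5.6) are the all-split case). From the per-place
identity `padicValNat_sum_fibre_eq` (`TamagawaQuadraticPlaces.lean`) this file PROVES, for EVERY
elliptic `E/ℚ`, every `p ≥ 5` and every quadratic `K` whose non-split bad primes are multiplicative
with `E[p]` ramified (hypothesis `hbad`; vacuous under the classical Heegner hypothesis):

* `padicValNat_tamagawaProduct_quadraticTwist_eq` — `ord_p ∏_ℓ c_ℓ(E^{(d_K)}) = ord_p ∏_ℓ c_ℓ(E)`;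
* `padicValNat_tamagawaProduct_baseChange_quadratic` —
  `ord_p ∏_w c_w(E/K) = ord_p ∏_ℓ c_ℓ(E) + ord_p ∏_ℓ c_ℓ(E^{(d_K)})`, and `… = 2·ord_p ∏_ℓ c_ℓ(E)`
  (`…_eq_two_mul`) — the Tamagawa products being finite products over the places
  (`mulSupport_localTamagawaNumber_finite_holds`), the `K`-side regrouped along the finite fibres of
  `w ↦ w ∩ ℤ` (`Finset.sum_fiberwise_of_maps_to`);
* `tamagawaDescentAt_of_isErratumField` — **the link (C) `TamagawaDescentAt` of
  `CastellaErratum.lean` for every erratum field, with NO semistability**;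
* `section5_tamagawaRelation_holds` — **DISCHARGE of the named fact
  `Castella2018.section5_tamagawaRelation`** (its `Semistable` and `q ∣ d_K` hypotheses are idle).

These also make the per-pair "decidable side conditions" `htam` of the Kriz–Li / BDP descents
(`KrizLi2019/SexticTwistBSDThreeDescent`, `X11b/BDPRouteDescent`) class-wide theorems at `p ≥ 5`.
The end forms of route R1 with (C) discharged are in `CastellaErratumTamagawa.lean`.
-/

noncomputable section

open scoped Classical

open WeierstrassCurve NumberField IsDedekindDomain Literature.NumberTheory.EllipticCurves
  Literature.NumberTheory.EllipticCurves.Rank1Residual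

namespace Summit.BirchSwinnertonDyer.Rank1Residual.X11b

section Assembly

/-- `ord_p` of a finite product of non-zero naturals is the sum of the `ord_p`. [folklore] -/
private theorem padicValNat_finsetProd {ι : Type*} (p : ℕ) [Fact p.Prime] (s : Finset ι)
    (f : ι → ℕ) (hf : ∀ i ∈ s, f i ≠ 0) :
    padicValNat p (∏ i ∈ s, f i) = ∑ i ∈ s, padicValNat p (f i) := by
  classical
  induction s using Finset.induction_on with
  | empty => simp
  | insert a s ha ih =>
    rw [Finset.prod_insert ha, Finset.sum_insert ha,
      padicValNat.mul (hf a (Finset.mem_insert_self a s))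
        (Finset.prod_ne_zero_iff.mpr fun i hi => hf i (Finset.mem_insert_of_mem hi)),
      ih fun i hi => hf i (Finset.mem_insert_of_mem hi)]

variable (W : WeierstrassCurve ℚ) [W.IsElliptic] [W.IsGloballyMinimal] (p : ℕ) [Fact p.Prime]
  (K : Type) [Field K] [NumberField K] (Wd : WeierstrassCurve ℚ) [Wd.IsElliptic]

/-- **Tamagawa numbers of a quadratic twist, `p`-adically (`p ≥ 5`):
`ord_p ∏_ℓ c_ℓ(E^{(d_K)}) = ord_p ∏_ℓ c_ℓ(E)`** for `W/ℚ` globally minimal elliptic, `K` quadratic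
with the bad-prime hypothesis `hbad` of `padicValNat_sum_fibre_eq` (vacuous under the classical
Heegner hypothesis "every `ℓ ∣ N` splits"), and any elliptic model `Wd` of `E^{(d_K)}`. This is the
per-pair "decidable side condition" `htam` of the Kriz–Li 2019 / BDP descents
(`KrizLi2019/SexticTwistBSDThreeDescent`, `X11b/BDPRouteDescent`) at `p ≥ 5`, now class-wide:
Jetchev–Skinner–Wan 2017 §7.3.1 (eq:tamK). Proof: both Tamagawa products are finite products over a
common finite set of places (`mulSupport_localTamagawaNumber_finite_holds`), and place by place
`ord_p c_v(E^{(d)}) = ord_p c_v(E)`. [cite: JetchevSkinnerWan2017, §7.3.1 (eq:tamK)] -/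
theorem padicValNat_tamagawaProduct_quadraticTwist_eq (hp : 5 ≤ p) (h2 : Module.finrank ℚ K = 2)
    (hbad : ∀ (ℓ : ℕ) [Fact ℓ.Prime], ℓ ∣ W.conductorNorm ℤ → ¬ SplitsIn K ℓ →
      Mult W ℓ ∧ ¬ p ∣ padicValInt ℓ W.minimalDiscriminantInt)
    (hWd : ∃ C : VariableChange ℚ, C • W.quadraticTwist (NumberField.discr K : ℚ) = Wd) :
    padicValNat p Wd.tamagawaProduct = padicValNat p W.tamagawaProduct := by
  obtain ⟨C, hC⟩ := hWd
  haveI hEK : (W.baseChange K).IsElliptic := by rw [baseChange]; infer_instance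
  set cQ : HeightOneSpectrum (𝓞 ℚ) → ℕ := fun v =>
    (W.baseChange (v.adicCompletion ℚ)).localTamagawaNumber (v.adicCompletionIntegers ℚ) with hcQ
  set cD : HeightOneSpectrum (𝓞 ℚ) → ℕ := fun v =>
    (Wd.baseChange (v.adicCompletion ℚ)).localTamagawaNumber (v.adicCompletionIntegers ℚ) with hcD
  have hfinQ : (Function.mulSupport cQ).Finite := W.mulSupport_localTamagawaNumber_finite_holds
  have hfinD : (Function.mulSupport cD).Finite := Wd.mulSupport_localTamagawaNumber_finite_holds
  set S : Finset (HeightOneSpectrum (𝓞 ℚ)) := hfinQ.toFinset ∪ hfinD.toFinset with hS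
  have hsubQ : Function.mulSupport cQ ⊆ ↑S := fun v hv => by
    rw [Finset.mem_coe, hS, Finset.mem_union]; exact Or.inl (hfinQ.mem_toFinset.mpr hv)
  have hsubD : Function.mulSupport cD ⊆ ↑S := fun v hv => by
    rw [Finset.mem_coe, hS, Finset.mem_union]; exact Or.inr (hfinD.mem_toFinset.mpr hv)
  rw [show Wd.tamagawaProduct = ∏ᶠ v, cD v from rfl, show W.tamagawaProduct = ∏ᶠ v, cQ v from rfl,
    finprod_eq_prod_of_mulSupport_subset cD hsubD, finprod_eq_prod_of_mulSupport_subset cQ hsubQ,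
    padicValNat_finsetProd p S cD fun v _ => Wd.localTamagawaNumber_baseChange_ne_zero v,
    padicValNat_finsetProd p S cQ fun v _ => W.localTamagawaNumber_baseChange_ne_zero v]
  exact Finset.sum_congr rfl fun v _ => (padicValNat_sum_fibre_eq W p hp K h2 hbad Wd hC v).2

/-- **Tamagawa numbers in a quadratic base change, `p`-adically (`p ≥ 5`):
`ord_p ∏_w c_w(E/K) = ord_p ∏_ℓ c_ℓ(E) + ord_p ∏_ℓ c_ℓ(E^{(d_K)})`** — Castella 2018 §5's "immediate
relation" / Jetchev–Skinner–Wan 2017 (eq:tamK) / CGLS 2022 (5.6), for `W/ℚ` globally minimal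
elliptic, `K` quadratic with the bad-prime hypothesis `hbad` (each non-split bad prime is
multiplicative with `E[p]` ramified; vacuous under the classical Heegner hypothesis), and any
elliptic model `Wd` of `E^{(d_K)}`. Proof: the Tamagawa product of `E_K` is a finite product over the
places of `K`, regrouped along the finite fibres of `w ↦ w ∩ ℤ` (`Finset.sum_fiberwise_of_maps_to`),
and the per-place identity `padicValNat_sum_fibre_eq`.
[cite: Castella2018, §5 (arXiv:1704.06608 p. 12), Tamagawa relation]
[cite: JetchevSkinnerWan2017, §7.3.1 (eq:tamK)] -/
theorem padicValNat_tamagawaProduct_baseChange_quadratic (hp : 5 ≤ p)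
    (h2 : Module.finrank ℚ K = 2)
    (hbad : ∀ (ℓ : ℕ) [Fact ℓ.Prime], ℓ ∣ W.conductorNorm ℤ → ¬ SplitsIn K ℓ →
      Mult W ℓ ∧ ¬ p ∣ padicValInt ℓ W.minimalDiscriminantInt)
    (hWd : ∃ C : VariableChange ℚ, C • W.quadraticTwist (NumberField.discr K : ℚ) = Wd) :
    padicValNat p (W.baseChange K).tamagawaProduct =
      padicValNat p W.tamagawaProduct + padicValNat p Wd.tamagawaProduct := by
  obtain ⟨C, hC⟩ := hWd
  haveI hEK : (W.baseChange K).IsElliptic := by rw [baseChange]; infer_instance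
  -- the three local Tamagawa functions
  set cK : HeightOneSpectrum (𝓞 K) → ℕ := fun w =>
    ((W.baseChange K).baseChange (w.adicCompletion K)).localTamagawaNumber
      (w.adicCompletionIntegers K) with hcK
  set cQ : HeightOneSpectrum (𝓞 ℚ) → ℕ := fun v =>
    (W.baseChange (v.adicCompletion ℚ)).localTamagawaNumber (v.adicCompletionIntegers ℚ) with hcQ
  set cD : HeightOneSpectrum (𝓞 ℚ) → ℕ := fun v =>
    (Wd.baseChange (v.adicCompletion ℚ)).localTamagawaNumber (v.adicCompletionIntegers ℚ) with hcD
  have hfinK : (Function.mulSupport cK).Finite :=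
    (W.baseChange K).mulSupport_localTamagawaNumber_finite_holds
  have hfinQ : (Function.mulSupport cQ).Finite := W.mulSupport_localTamagawaNumber_finite_holds
  have hfinD : (Function.mulSupport cD).Finite := Wd.mulSupport_localTamagawaNumber_finite_holds
  -- fibres of `K → ℚ` on places and the finite index sets
  set F : HeightOneSpectrum (𝓞 ℚ) → Finset (HeightOneSpectrum (𝓞 K)) := fun v =>
    (HeightOneSpectrum.finite_setOf_under_eq_of_numberField (K := K) v).toFinset with hF
  have hmemF : ∀ v w, w ∈ F v ↔ w.under (𝓞 ℚ) = v := fun v w => by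
    simp [hF, Set.Finite.mem_toFinset]
  set SQ : Finset (HeightOneSpectrum (𝓞 ℚ)) :=
    hfinK.toFinset.image (fun w => w.under (𝓞 ℚ)) ∪ hfinQ.toFinset ∪ hfinD.toFinset with hSQ
  set SK : Finset (HeightOneSpectrum (𝓞 K)) := SQ.biUnion F with hSK
  have hsubK : Function.mulSupport cK ⊆ ↑SK := by
    intro w hw
    rw [Finset.mem_coe, hSK, Finset.mem_biUnion]
    refine ⟨w.under (𝓞 ℚ), ?_, (hmemF _ _).mpr rfl⟩
    rw [hSQ, Finset.mem_union, Finset.mem_union, Finset.mem_image]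
    exact Or.inl (Or.inl ⟨w, hfinK.mem_toFinset.mpr hw, rfl⟩)
  have hsubQ : Function.mulSupport cQ ⊆ ↑SQ := fun v hv => by
    rw [Finset.mem_coe, hSQ, Finset.mem_union, Finset.mem_union]
    exact Or.inl (Or.inr (hfinQ.mem_toFinset.mpr hv))
  have hsubD : Function.mulSupport cD ⊆ ↑SQ := fun v hv => by
    rw [Finset.mem_coe, hSQ, Finset.mem_union, Finset.mem_union]
    exact Or.inr (hfinD.mem_toFinset.mpr hv)
  -- `ord_p` of the three products as sums over the index sets
  have hK' : padicValNat p (W.baseChange K).tamagawaProduct = ∑ w ∈ SK, padicValNat p (cK w) := by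
    rw [show (W.baseChange K).tamagawaProduct = ∏ᶠ w, cK w from rfl,
      finprod_eq_prod_of_mulSupport_subset cK hsubK]
    exact padicValNat_finsetProd p SK cK fun w _ =>
      (W.baseChange K).localTamagawaNumber_baseChange_ne_zero w
  have hQ' : padicValNat p W.tamagawaProduct = ∑ v ∈ SQ, padicValNat p (cQ v) := by
    rw [show W.tamagawaProduct = ∏ᶠ v, cQ v from rfl,
      finprod_eq_prod_of_mulSupport_subset cQ hsubQ]
    exact padicValNat_finsetProd p SQ cQ fun v _ => W.localTamagawaNumber_baseChange_ne_zero v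
  have hD' : padicValNat p Wd.tamagawaProduct = ∑ v ∈ SQ, padicValNat p (cD v) := by
    rw [show Wd.tamagawaProduct = ∏ᶠ v, cD v from rfl,
      finprod_eq_prod_of_mulSupport_subset cD hsubD]
    exact padicValNat_finsetProd p SQ cD fun v _ => Wd.localTamagawaNumber_baseChange_ne_zero v
  -- regroup the `K`-side along the fibres
  have hmaps : ∀ w ∈ SK, w.under (𝓞 ℚ) ∈ SQ := by
    intro w hw
    rw [hSK, Finset.mem_biUnion] at hw
    obtain ⟨v, hv, hwv⟩ := hw
    rwa [(hmemF v w).mp hwv]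
  have hfib : ∀ v ∈ SQ, SK.filter (fun w => w.under (𝓞 ℚ) = v) = F v := by
    intro v hv
    ext w
    simp only [Finset.mem_filter, hmemF]
    constructor
    · exact fun h => h.2
    · intro h
      refine ⟨?_, h⟩
      rw [hSK, Finset.mem_biUnion]
      exact ⟨v, hv, (hmemF v w).mpr h⟩
  rw [hK', hQ', hD', ← Finset.sum_fiberwise_of_maps_to hmaps, ← Finset.sum_add_distrib]
  refine Finset.sum_congr rfl fun v hv => ?_
  rw [hfib v hv]
  exact (padicValNat_sum_fibre_eq W p hp K h2 hbad Wd hC v).1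

/-- **`ord_p ∏_w c_w(E/K) = 2 · ord_p ∏_ℓ c_ℓ(E)`** (`p ≥ 5`) — the two theorems above combined;
under the classical Heegner hypothesis this is Jetchev–Skinner–Wan 2017 (eq:tamK)
"`∏_w c_w(E/K) = ∏_ℓ c_ℓ(E/ℚ)²`" read `p`-adically. [cite: JetchevSkinnerWan2017, §7.3.1 (eq:tamK)] -/
theorem padicValNat_tamagawaProduct_baseChange_quadratic_eq_two_mul (hp : 5 ≤ p)
    (h2 : Module.finrank ℚ K = 2)
    (hbad : ∀ (ℓ : ℕ) [Fact ℓ.Prime], ℓ ∣ W.conductorNorm ℤ → ¬ SplitsIn K ℓ →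
      Mult W ℓ ∧ ¬ p ∣ padicValInt ℓ W.minimalDiscriminantInt) :
    padicValNat p (W.baseChange K).tamagawaProduct = 2 * padicValNat p W.tamagawaProduct := by
  have hd : (NumberField.discr K : ℚ) ≠ 0 := by exact_mod_cast NumberField.discr_ne_zero K
  haveI := W.isElliptic_quadraticTwist hd
  rw [padicValNat_tamagawaProduct_baseChange_quadratic W p K
      (W.quadraticTwist (NumberField.discr K : ℚ)) hp h2 hbad ⟨1, one_smul _ _⟩,
    padicValNat_tamagawaProduct_quadraticTwist_eq W p K (W.quadraticTwist (NumberField.discr K : ℚ))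
      hp h2 hbad ⟨1, one_smul _ _⟩, two_mul]

end Assembly

section Erratum

/-- **Link (C) of route R1, PROVED for every `E`** (`CastellaErratum.lean`, `TamagawaDescentAt`):
for `W/ℚ` globally minimal elliptic, a prime `p ≥ 5`, a multiplicative prime `q` with `E[p]`
ramified (`p ∤ ord_q(Δ_min)`), an erratum field `K` for `q` (every prime of `N_E` other than `q`
splits in `K`) and a model `Wd` of `E^{(d_K)}`: `ord_p ∏_w c_w(E/K) = ord_p ∏c(E) + ord_p ∏c(E^D)`.
The bad-prime hypothesis of `padicValNat_tamagawaProduct_baseChange_quadratic` holds: a non-split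
bad prime is `q`. Castella 2018 §5 / erratum "the same argument", now with NO semistability.
[cite: Castella2018, §5 (arXiv:1704.06608 p. 12), Tamagawa relation]
[cite: Castella2018Erratum, Thm. A′ and "the same argument as in [Cas18, §5]" (p. 1)] -/
theorem tamagawaDescentAt_of_isErratumField (W : WeierstrassCurve ℚ) [W.IsElliptic]
    [W.IsGloballyMinimal] (p : ℕ) [Fact p.Prime] (hp : 5 ≤ p) (q : ℕ) [Fact q.Prime]
    (hmq : Mult W q) (hvq : ¬ p ∣ padicValInt q W.minimalDiscriminantInt)
    (K : Type) [Field K] [NumberField K] (hK : IsErratumField W K q)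
    (Wd : WeierstrassCurve ℚ) [Wd.IsElliptic]
    (hWd : ∃ C : VariableChange ℚ, C • W.quadraticTwist (NumberField.discr K : ℚ) = Wd) :
    TamagawaDescentAt W p K Wd := by
  refine padicValNat_tamagawaProduct_baseChange_quadratic W p K Wd hp hK.1.1 (fun ℓ _ hℓN hns => ?_)
    hWd
  have hℓq : ℓ = q := by
    by_contra hne
    exact hns (hK.2.2.1 ℓ Fact.out hℓN hne)
  subst hℓq
  exact ⟨hmq, hvq⟩

/-- **DISCHARGE of the named fact `Castella2018.section5_tamagawaRelation`** (Castella, Camb. J.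
Math. 6 (2018) §5, the "immediate relation" of Tamagawa numbers for semistable `E`,
`Literature/…/Castella2018/Section5Bookkeeping.lean`): it is the special case `Semistable W` (not
used), `3 < p`, `q ∣ d_K` (not used) of `padicValNat_tamagawaProduct_baseChange_quadratic`.
[cite: Castella2018, §5 (arXiv:1704.06608 p. 12), Tamagawa relation] -/
theorem section5_tamagawaRelation_holds : Castella2018.section5_tamagawaRelation := by
  intro W _ _ p q _ _ K _ _ Wd _ _ _ hp3 _ hmq hvq hKiq _ hsplit hWd
  have hp : p.Prime := Fact.out
  have hp5 : 5 ≤ p := by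
    have h4 : p ≠ 4 := by rintro rfl; exact absurd hp (by decide)
    omega
  refine padicValNat_tamagawaProduct_baseChange_quadratic W p K Wd hp5 hKiq.1
    (fun ℓ _ hℓN hns => ?_) hWd
  have hℓq : ℓ = q := by
    by_contra hne
    exact hns (hsplit ℓ Fact.out hℓN hne)
  subst hℓq
  exact ⟨hmq, hvq⟩

end Erratum

end Summit.BirchSwinnertonDyer.Rank1Residual.X11b

end
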